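import Summits.BirchSwinnertonDyer.BirchSwinnertonDyer.Theses.PAdicOrderV2
import Literature.NumberTheory.EllipticCurves.LFunctionSmulProofs
import Literature.NumberTheory.EllipticCurves.RootNumberSmulProofs
import Literature.NumberTheory.EllipticCurves.GlobalMinimalModelProofs
import Literature.NumberTheory.DiophantineGeometry.Conductor

/-!
# BirchSwinnertonDyer / PAdicOrderV2 — crux `PAdicOrderThesisR2` (stmt-0487), line `Sketch`:
# normal form of `X` and the necessity of modularity

`X = PAdicOrderThesisR2`: every `E/ℚ` (globally minimal `W`) has a good ordinary prime `p` and a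
newform `f` with `ord_{T=0} L_p(f, α_p, T) = r_an(W) = r_MW(W)`.

This file lands, as Theorems lemmas, the normal-form findings that so far lived only in the crux
work file of the disprover (`Cruxes/PAdicOrderThesisR2/Disproof.lean`, section (n)):

* `thesis_iff_bsd_and_onePrimeComparison` — **`X ↔ BSD-rank(gm) ∧ OnePrimeComparison`**: `X` is
  exactly the conjunction of the rank conjecture for globally minimal models
  (`∀ W, r_an(W) = r_MW(W)`; the summit conjunct, by the route's proved `closes`) and of the
  one-prime `p`-adic comparison (`∀ W, ∃` good ordinary `p`, `∃` newform `f`, `ord_T L_p = r_an`;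
  the `∃p`-weakening of crux #2 `PAdicOrderComparisonR2`, stmt-0489). Pure logic.
* `modularity_of_thesis` — **`X` proves modularity** in the weak form "every globally minimal
  elliptic `W/ℚ` has a newform at some level".
* `exists_isNewformOf_of_thesis` — modulo Carayol's theorem `IsNewformOf.level_eq_conductorNorm`
  (level of the newform of `E` = conductor of `E`; Carayol 1986, Diamond–Shurman Thm. 8.8.1, a
  named fact of the tree), **`X` implies the Modularity Theorem, Version `L`, verbatim as the tree
  states it** (`ModularForms.exists_isNewformOf`: every elliptic `W/ℚ` has a newform of level `N_W`):
  pass to a global minimal model `C • W` (`hasGlobalMinimalModel_rat_holds`, Silverman AEC VIII.8.3),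
  take the newform `X` provides there, move its level to `N_{C • W} = N_W` (`conductorNorm_smul`) and
  transport `IsNewformOf` along `C` (`LFunction_smul`).
* `stub_modularity_iff_exists_isNewformOf` — the line's `stub_modularity` IS `exists_isNewformOf`
  (`Iff.rfl`), recorded so that the item's blocker is named by a kernel-checked equivalence.

Consequence for the item (lead cycle 6): `X` is not closable in the tree before the named fact
`exists_isNewformOf` (BCDT 2001, Thm. A) is discharged — independently of all `p`-adic input — and
every cover of `X` already landed (`padicOrderThesisR2_of_items`, `…_of_padicBSDrank_of_bsd`,
`…_of_pinchPrime_of_bsd`) takes it (or an `∃f`-packaged sibling crux) as a hypothesis.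

Nothing is asserted unconditionally about `X`; `X` and Carayol enter as explicit hypotheses.
-/

-- single-conjunct summit: `Summit.BirchSwinnertonDyer.BirchSwinnertonDyer.…` repeats the name by design
set_option linter.dupNamespace false

namespace Summit.BirchSwinnertonDyer.BirchSwinnertonDyer.Cruxes.PAdicOrderThesisR2.KatoSandwich

open scoped MatrixGroups ModularForm
open CongruenceSubgroup
open Literature.NumberTheory.EllipticCurves Literature.NumberTheory.EllipticCurves.ModularForms
open Summit.BirchSwinnertonDyer.BirchSwinnertonDyer.Theses.PAdicOrderV2

/-! ## Normal form -/

/-- **`X ↔ BSD-rank(gm) ∧ OnePrimeComparison`.** The thesis `PAdicOrderThesisR2` is equivalent to the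
conjunction of (i) the rank conjecture for globally minimal models, `r_an(W) = r_MW(W)`, and (ii) the
one-prime comparison: every globally minimal elliptic `W` has a good ordinary prime `p` and a newform
`f` with `ord_{T=0} L_p(f, α_p, T) = r_an(W)`. (Pure logic: the two equalities of `X` give (i) by
injectivity of `ℕ → ℕ∞` and (ii) by forgetting one of them; conversely rewrite `r_an = r_MW`.)
Adapted from the disprover's `thesis_iff_bsd_and_onePrime` (crux work file, 2026-08-16). [folklore] -/
theorem thesis_iff_bsd_and_onePrimeComparison :
    PAdicOrderThesisR2 ↔
      (∀ (W : WeierstrassCurve ℚ) [W.IsElliptic] [W.IsGloballyMinimal],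
          W.analyticRank = W.mordellWeilRank) ∧
      (∀ (W : WeierstrassCurve ℚ) [W.IsElliptic] [W.IsGloballyMinimal],
        ∃ (p : ℕ) (_ : Fact p.Prime), IsOrdinaryAt W p ∧
          ∃ (N : ℕ) (_ : NeZero N) (f : CuspForm (Gamma0 N) 2), IsNewformOf W f ∧
            (padicLFunction f (unitRoot W p : ℚ_[p])).order = W.analyticRank) := by
  constructor
  · intro hX
    refine ⟨fun W _ _ ↦ ?_, fun W _ _ ↦ ?_⟩
    · obtain ⟨p, hp, -, N, hN, f, -, han, hmw⟩ := hX W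
      exact_mod_cast han.symm.trans hmw
    · obtain ⟨p, hp, hord, N, hN, f, hf, han, -⟩ := hX W
      exact ⟨p, hp, hord, N, hN, f, hf, han⟩
  · rintro ⟨hB, hC⟩ W _ _
    obtain ⟨p, hp, hord, N, hN, f, hf, han⟩ := hC W
    refine ⟨p, hp, hord, N, hN, f, hf, han, ?_⟩
    rw [han]
    exact_mod_cast hB W

/-! ## `X` proves modularity -/

/-- **`X` proves modularity (weak form).** If `PAdicOrderThesisR2` holds then every globally minimal
elliptic `W/ℚ` has a newform `f ∈ S₂(Γ₀(N))` at some level `N` with `aₙ(f) = aₙ(W)` — the `∃f` of `X`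
with its `p`-adic clauses forgotten. Adapted from the disprover's `modularity_of_thesis`. [folklore] -/
theorem modularity_of_thesis (hX : PAdicOrderThesisR2) :
    ∀ (W : WeierstrassCurve ℚ) [W.IsElliptic] [W.IsGloballyMinimal],
      ∃ (N : ℕ) (_ : NeZero N) (f : CuspForm (Gamma0 N) 2), IsNewformOf W f := by
  intro W _ _
  obtain ⟨-, -, -, N, hN, f, hf, -, -⟩ := hX W
  exact ⟨N, hN, f, hf⟩

/-- **`X` implies the Modularity Theorem (Version `L`) modulo Carayol.** Assume Carayol's theorem
`IsNewformOf.level_eq_conductorNorm` at every level (the level of a newform of `E` is the conductor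
`N_E`; Carayol 1986, Diamond–Shurman Thm. 8.8.1) and `X = PAdicOrderThesisR2`. Then
`ModularForms.exists_isNewformOf` holds verbatim: every elliptic `W/ℚ` has a newform of level `N_W`.
Proof: pass to a global minimal model `C • W` (`WeierstrassCurve.hasGlobalMinimalModel_rat_holds`,
Silverman AEC VIII.8.3), take the newform `f` of level `N` that `X` provides for `C • W`; `N = N_{C • W}`
(Carayol) `= N_W` (`WeierstrassCurve.conductorNorm_smul`), and `IsNewformOf (C • W) f → IsNewformOf W f`
since the Dirichlet coefficients are isomorphism invariants (`WeierstrassCurve.LFunction_smul`).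
So no proof of `X` exists in the tree before modularity is discharged there. [cite: Carayol1986] -/
theorem exists_isNewformOf_of_thesis :
    (∀ (N : ℕ) [NeZero N], IsNewformOf.level_eq_conductorNorm (N := N)) →
      PAdicOrderThesisR2 → exists_isNewformOf := by
  intro hlev hX W _ _
  obtain ⟨C, hC⟩ := WeierstrassCurve.hasGlobalMinimalModel_rat_holds W
  haveI : (C • W).IsGloballyMinimal := hC
  obtain ⟨N, hN, f, hf⟩ := modularity_of_thesis hX (C • W)
  have hlevN : N = (C • W).conductorNorm ℤ := hlev N hf
  rw [WeierstrassCurve.conductorNorm_smul ℤ W C] at hlevN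
  subst hlevN
  refine ⟨f, hf.1, fun n ↦ ?_⟩
  rw [hf.2 n, WeierstrassCurve.LFunction_smul]

/-- The line's `stub_modularity` (modularity inlined exactly as the route's glue `CruxesToThesis`
carries it) **is** the named fact `ModularForms.exists_isNewformOf` (`Iff.rfl`): the stub is blocked
on, and only on, that fact. [folklore] -/
theorem stub_modularity_iff_exists_isNewformOf :
    (∀ (W : WeierstrassCurve ℚ) [W.IsElliptic] [NeZero (W.conductorNorm ℤ)],
      ∃ f : CuspForm (Gamma0 (W.conductorNorm ℤ)) 2, IsNewformOf W f) ↔ exists_isNewformOf :=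
  Iff.rfl

/-- **Modulo Carayol, `X` and `X ∧ modularity` are the same statement**: the modularity stub costs the
line nothing beyond `X` itself. [cite: Carayol1986] -/
theorem thesis_iff_exists_isNewformOf_and_thesis
    (hlev : ∀ (N : ℕ) [NeZero N], IsNewformOf.level_eq_conductorNorm (N := N)) :
    PAdicOrderThesisR2 ↔ exists_isNewformOf ∧ PAdicOrderThesisR2 :=
  ⟨fun hX ↦ ⟨exists_isNewformOf_of_thesis hlev hX, hX⟩, fun h ↦ h.2⟩

end Summit.BirchSwinnertonDyer.BirchSwinnertonDyer.Cruxes.PAdicOrderThesisR2.KatoSandwich
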